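import Literature.MathematicalPhysics.QuantumLattice.KohnLuttingerChannelStates
import HarnessLib

/-!
# The radial projection onto the Fermi curve is `D₄`-equivariant and transports channel functions

Topic `Literature/MathematicalPhysics/QuantumLattice`; continues `KohnLuttingerChannelStates`.
For `-4 < μ < 0` the Fermi curve of `ε = squareDispersion 1 0` is star-shaped around `Γ = 0`, and the
**radial projection** `k ↦ fermiPolar μ (arg(k₀ + i k₁))` (the Fermi point on the ray through
`k ≠ 0`) is the natural transport between the Fermi curves at two levels `μ, μ'`:

* `fermiPolar_add_pi_div_two_eq_rot`, `fermiPolar_neg_eq_refl`, `fermiPolar_congr_angle` — the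
  parametrisation intertwines the quarter turn / the reflection with `θ ↦ θ + π/2`, `θ ↦ -θ`, and
  factors through `ℝ/2πℤ`;
* `fermiPolar_arg_fermiPolar` — projecting the level-`μ'` curve radially gives the level-`μ` curve
  with the SAME angle: `fermiPolar μ (arg (fermiPolar μ' θ)) = fermiPolar μ θ`;
* `fermiPolar_arg_rot`, `fermiPolar_arg_refl`, `fermiPolar_arg_d4Momentum` — **`D₄`-equivariance**
  of the radial projection on `k ≠ 0`;
* `measurable_fermiPolar_arg` — it is Borel measurable;
* `inChannel_radialTransport` — **transport of channel functions**: if `ψ` is in the channel `χ`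
  (`d4Project χ ψ = ψ` pointwise) then so is `k ↦ if k = 0 then 0 else ψ (fermiPolar μ (arg k))`.

Everything is proved; no definitions (the projection is written out). [folklore]
-/

noncomputable section

open Real Set Filter MeasureTheory Complex
open scoped Topology

namespace Literature.MathematicalPhysics.QuantumLattice

section Radial

variable {μ : ℝ} (hμ₁ : -4 < μ) (hμ₂ : μ < 0)
include hμ₁ hμ₂

/-! ### The parametrisation intertwines the point group -/

/-- `fermiPolar` factors through the angle `ℝ/2πℤ`. [folklore] -/
theorem fermiPolar_congr_angle {θ₁ θ₂ : ℝ} (h : (θ₁ : Real.Angle) = θ₂) : fermiPolar μ θ₁ = fermiPolar μ θ₂ :=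
  (fermiPolar_eq_fermiPolar_iff hμ₁ hμ₂).2 h

/-- **Quarter turn**: `fermiPolar μ (θ + π/2) = rot (fermiPolar μ θ)`. [folklore] -/
theorem fermiPolar_add_pi_div_two_eq_rot (θ : ℝ) :
    fermiPolar μ (θ + π / 2) = rotMomentum (fermiPolar μ θ) := by
  have h := bandFermiRadius_add_pi_div_two hμ₁ hμ₂ θ
  ext i; fin_cases i
  · simp [fermiPolar_apply_zero, h, Real.cos_add_pi_div_two]
  · simp [fermiPolar_apply_one, h, Real.sin_add_pi_div_two]

/-- **Reflection**: `fermiPolar μ (-θ) = refl (fermiPolar μ θ)`. [folklore] -/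
theorem fermiPolar_neg_eq_refl (θ : ℝ) : fermiPolar μ (-θ) = reflMomentum (fermiPolar μ θ) := by
  have h := bandFermiRadius_neg hμ₁ hμ₂ θ
  ext i; fin_cases i
  · simp [fermiPolar_apply_zero, h, Real.cos_neg]
  · simp [fermiPolar_apply_one, h, Real.sin_neg]

/-! ### The angle of a momentum -/

omit hμ₁ hμ₂ in
/-- The complex number `k₀ + i k₁` of a non-zero momentum is non-zero. [folklore] -/
theorem complex_mk_ne_zero {k : Momentum} (hk : k ≠ 0) : (⟨k 0, k 1⟩ : ℂ) ≠ 0 := by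
  intro h
  apply hk
  have h0 : k 0 = 0 := by simpa using congrArg Complex.re h
  have h1 : k 1 = 0 := by simpa using congrArg Complex.im h
  ext i; fin_cases i
  · exact h0
  · exact h1

omit hμ₁ hμ₂ in
/-- `z(rot k) = i · z(k)`. [folklore] -/
theorem complex_mk_rotMomentum (k : Momentum) :
    (⟨rotMomentum k 0, rotMomentum k 1⟩ : ℂ) = Complex.I * ⟨k 0, k 1⟩ := by
  apply Complex.ext <;> simp

omit hμ₁ hμ₂ in
/-- `z(refl k) = conj z(k)`. [folklore] -/
theorem complex_mk_reflMomentum (k : Momentum) :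
    (⟨reflMomentum k 0, reflMomentum k 1⟩ : ℂ) = (starRingEnd ℂ) ⟨k 0, k 1⟩ := by
  apply Complex.ext <;> simp

omit hμ₁ hμ₂ in
/-- The angle of a polar point: `arg (fermiPolar μ' θ) = θ (mod 2π)`, for any level `μ'` in the band.
[folklore] -/
theorem arg_fermiPolar_coe_angle {μ' : ℝ} (hμ₁' : -4 < μ') (hμ₂' : μ' < 0) (θ : ℝ) :
    (Complex.arg ⟨fermiPolar μ' θ 0, fermiPolar μ' θ 1⟩ : Real.Angle) = θ := by
  have hR := bandFermiRadius_pos hμ₁' hμ₂' θ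
  have hz : (⟨fermiPolar μ' θ 0, fermiPolar μ' θ 1⟩ : ℂ) =
      (bandFermiRadius μ' θ : ℂ) * (Complex.cos θ + Complex.sin θ * Complex.I) := by
    rw [← Complex.exp_mul_I]
    apply Complex.ext
    · simp [fermiPolar_apply_zero, Complex.exp_ofReal_mul_I_re]
    · simp [fermiPolar_apply_one, Complex.exp_ofReal_mul_I_im]
  rw [hz, Complex.arg_mul_cos_add_sin_mul_I_eq_toIocMod hR]
  -- `toIocMod` differs from `θ` by an integer multiple of `2π`
  rw [Real.Angle.angle_eq_iff_two_pi_dvd_sub]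
  refine ⟨-toIocDiv Real.two_pi_pos (-π) θ, ?_⟩
  rw [toIocMod, zsmul_eq_mul]
  push_cast
  ring

/-- **Radial projection of the level-`μ'` Fermi curve is the level-`μ` Fermi curve at the same angle**:
`fermiPolar μ (arg (fermiPolar μ' θ)) = fermiPolar μ θ`. [folklore] -/
theorem fermiPolar_arg_fermiPolar {μ' : ℝ} (hμ₁' : -4 < μ') (hμ₂' : μ' < 0) (θ : ℝ) :
    fermiPolar μ (Complex.arg ⟨fermiPolar μ' θ 0, fermiPolar μ' θ 1⟩) = fermiPolar μ θ :=
  fermiPolar_congr_angle hμ₁ hμ₂ (arg_fermiPolar_coe_angle hμ₁' hμ₂' θ)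

/-! ### `D₄`-equivariance of the radial projection -/

/-- **Quarter-turn equivariance** on `k ≠ 0`. [folklore] -/
theorem fermiPolar_arg_rot {k : Momentum} (hk : k ≠ 0) :
    fermiPolar μ (Complex.arg ⟨rotMomentum k 0, rotMomentum k 1⟩) =
      rotMomentum (fermiPolar μ (Complex.arg ⟨k 0, k 1⟩)) := by
  rw [← fermiPolar_add_pi_div_two_eq_rot hμ₁ hμ₂]
  refine fermiPolar_congr_angle hμ₁ hμ₂ ?_
  rw [complex_mk_rotMomentum, Complex.arg_mul_coe_angle Complex.I_ne_zero (complex_mk_ne_zero hk),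
    Complex.arg_I, Real.Angle.coe_add, add_comm]

/-- **Reflection equivariance** (valid at every `k`). [folklore] -/
theorem fermiPolar_arg_refl (k : Momentum) :
    fermiPolar μ (Complex.arg ⟨reflMomentum k 0, reflMomentum k 1⟩) =
      reflMomentum (fermiPolar μ (Complex.arg ⟨k 0, k 1⟩)) := by
  rw [← fermiPolar_neg_eq_refl hμ₁ hμ₂]
  refine fermiPolar_congr_angle hμ₁ hμ₂ ?_
  rw [complex_mk_reflMomentum, Complex.arg_conj_coe_angle, Real.Angle.coe_neg]

omit hμ₁ hμ₂ in
/-- The quarter turn fixes only the origin. [folklore] -/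
theorem rotMomentum_ne_zero {k : Momentum} (hk : k ≠ 0) : rotMomentum k ≠ 0 := by
  intro h
  apply hk
  have h0 : rotMomentum k 0 = 0 := by rw [h]; rfl
  have h1 : rotMomentum k 1 = 0 := by rw [h]; rfl
  simp only [rotMomentum_apply_zero, rotMomentum_apply_one, neg_eq_zero] at h0 h1
  ext i; fin_cases i
  · exact h1
  · exact h0

omit hμ₁ hμ₂ in
/-- The reflection fixes only the origin… in particular maps non-zero momenta to non-zero ones.
[folklore] -/
theorem reflMomentum_ne_zero {k : Momentum} (hk : k ≠ 0) : reflMomentum k ≠ 0 := by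
  intro h
  apply hk
  have h0 : reflMomentum k 0 = 0 := by rw [h]; rfl
  have h1 : reflMomentum k 1 = 0 := by rw [h]; rfl
  simp only [reflMomentum_apply_zero, reflMomentum_apply_one, neg_eq_zero] at h0 h1
  ext i; fin_cases i
  · exact h0
  · exact h1

/-- **`D₄`-equivariance of the radial projection**: for every `γ ∈ D₄` and `k ≠ 0`,
`P(γ · k) = γ · P(k)`, `P k = fermiPolar μ (arg k)`. [folklore] -/
theorem fermiPolar_arg_d4Momentum (g : DihedralGroup 4) {k : Momentum} (hk : k ≠ 0) :
    fermiPolar μ (Complex.arg ⟨d4Momentum g k 0, d4Momentum g k 1⟩) =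
      d4Momentum g (fermiPolar μ (Complex.arg ⟨k 0, k 1⟩)) := by
  have hr := fun {q : Momentum} (hq : q ≠ 0) => fermiPolar_arg_rot hμ₁ hμ₂ hq
  have hk1 := rotMomentum_ne_zero hk
  have hk2 := rotMomentum_ne_zero hk1
  rcases g with i | i <;> fin_cases i
  · rfl
  · show fermiPolar μ (Complex.arg ⟨rotMomentum k 0, rotMomentum k 1⟩) =
      rotMomentum (fermiPolar μ (Complex.arg ⟨k 0, k 1⟩))
    rw [hr hk]
  · show fermiPolar μ (Complex.arg ⟨rotMomentum (rotMomentum k) 0, rotMomentum (rotMomentum k) 1⟩) =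
      rotMomentum (rotMomentum (fermiPolar μ (Complex.arg ⟨k 0, k 1⟩)))
    rw [hr hk1, hr hk]
  · show fermiPolar μ (Complex.arg ⟨rotMomentum (rotMomentum (rotMomentum k)) 0,
      rotMomentum (rotMomentum (rotMomentum k)) 1⟩) =
      rotMomentum (rotMomentum (rotMomentum (fermiPolar μ (Complex.arg ⟨k 0, k 1⟩))))
    rw [hr hk2, hr hk1, hr hk]
  · show fermiPolar μ (Complex.arg ⟨reflMomentum k 0, reflMomentum k 1⟩) =
      reflMomentum (fermiPolar μ (Complex.arg ⟨k 0, k 1⟩))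
    rw [fermiPolar_arg_refl hμ₁ hμ₂]
  · show fermiPolar μ (Complex.arg ⟨reflMomentum (rotMomentum k) 0, reflMomentum (rotMomentum k) 1⟩) =
      reflMomentum (rotMomentum (fermiPolar μ (Complex.arg ⟨k 0, k 1⟩)))
    rw [fermiPolar_arg_refl hμ₁ hμ₂, hr hk]
  · show fermiPolar μ (Complex.arg ⟨reflMomentum (rotMomentum (rotMomentum k)) 0,
      reflMomentum (rotMomentum (rotMomentum k)) 1⟩) =
      reflMomentum (rotMomentum (rotMomentum (fermiPolar μ (Complex.arg ⟨k 0, k 1⟩))))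
    rw [fermiPolar_arg_refl hμ₁ hμ₂, hr hk1, hr hk]
  · show fermiPolar μ (Complex.arg ⟨reflMomentum (rotMomentum (rotMomentum (rotMomentum k))) 0,
      reflMomentum (rotMomentum (rotMomentum (rotMomentum k))) 1⟩) =
      reflMomentum (rotMomentum (rotMomentum (rotMomentum (fermiPolar μ (Complex.arg ⟨k 0, k 1⟩)))))
    rw [fermiPolar_arg_refl hμ₁ hμ₂, hr hk2, hr hk1, hr hk]

/-! ### Measurability and the transport of channel functions -/

omit hμ₁ hμ₂ in
/-- `k ↦ k₀ + i k₁` is continuous. [folklore] -/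
theorem continuous_complex_mk : Continuous fun k : Momentum => (⟨k 0, k 1⟩ : ℂ) := by
  have h0 : Continuous fun k : Momentum => k 0 := PiLp.continuous_apply 2 _ 0
  have h1 : Continuous fun k : Momentum => k 1 := PiLp.continuous_apply 2 _ 1
  have h : Continuous fun k : Momentum => ((k 0 : ℝ) : ℂ) + ((k 1 : ℝ) : ℂ) * Complex.I :=
    (Complex.continuous_ofReal.comp h0).add ((Complex.continuous_ofReal.comp h1).mul continuous_const)
  refine h.congr fun k => ?_
  exact (Complex.mk_eq_add_mul_I _ _).symm

/-- The radial projection `k ↦ fermiPolar μ (arg k)` is Borel measurable. [folklore] -/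
theorem measurable_fermiPolar_arg :
    Measurable fun k : Momentum => fermiPolar μ (Complex.arg ⟨k 0, k 1⟩) :=
  (continuous_fermiPolar hμ₁ hμ₂).measurable.comp (Complex.measurable_arg.comp continuous_complex_mk.measurable)

omit hμ₁ hμ₂ in
/-- The point group fixes the origin. [folklore] -/
theorem d4Momentum_zero (g : DihedralGroup 4) : d4Momentum g (0 : Momentum) = 0 := by
  have hr : rotMomentum (0 : Momentum) = 0 := by ext i; fin_cases i <;> simp
  have hs : reflMomentum (0 : Momentum) = 0 := by ext i; fin_cases i <;> simp
  rcases g with i | i <;> fin_cases i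
  · rfl
  · show rotMomentum 0 = 0; rw [hr]
  · show rotMomentum (rotMomentum 0) = 0; rw [hr, hr]
  · show rotMomentum (rotMomentum (rotMomentum 0)) = 0; rw [hr, hr, hr]
  · show reflMomentum 0 = 0; rw [hs]
  · show reflMomentum (rotMomentum 0) = 0; rw [hr, hs]
  · show reflMomentum (rotMomentum (rotMomentum 0)) = 0; rw [hr, hr, hs]
  · show reflMomentum (rotMomentum (rotMomentum (rotMomentum 0))) = 0; rw [hr, hr, hr, hs]

omit hμ₁ hμ₂ in
/-- The point group maps non-zero momenta to non-zero momenta. [folklore] -/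
theorem d4Momentum_ne_zero (g : DihedralGroup 4) {k : Momentum} (hk : k ≠ 0) : d4Momentum g k ≠ 0 := by
  have hk1 := rotMomentum_ne_zero hk
  have hk2 := rotMomentum_ne_zero hk1
  have hk3 := rotMomentum_ne_zero hk2
  rcases g with i | i <;> fin_cases i
  · exact hk
  · exact hk1
  · exact hk2
  · exact hk3
  · exact reflMomentum_ne_zero hk
  · exact reflMomentum_ne_zero hk1
  · exact reflMomentum_ne_zero hk2
  · exact reflMomentum_ne_zero hk3

open scoped Classical in
/-- **Transport of channel functions along the radial projection**: if `d4Project χ ψ = ψ`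
(pointwise on all of momentum space) then the same holds for
`k ↦ if k = 0 then 0 else ψ (fermiPolar μ (arg k))` — the value `0` at the origin keeps the
identity at the one point where the projection is not equivariant. [folklore] -/
theorem inChannel_radialTransport {χ : D4Irrep} {ψ : Momentum → ℝ} (h : InChannel χ ψ) :
    InChannel χ (fun k : Momentum => if k = 0 then 0 else ψ (fermiPolar μ (Complex.arg ⟨k 0, k 1⟩))) := by
  funext k
  by_cases hk : k = 0
  · subst hk
    simp only [d4Project, d4Momentum_zero, if_true, mul_zero, Finset.sum_const_zero]
  · rw [d4Project, if_neg hk]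
    have hsum : ∀ g : DihedralGroup 4,
        χ.char g * (if d4Momentum g k = 0 then 0 else ψ (fermiPolar μ (Complex.arg ⟨d4Momentum g k 0, d4Momentum g k 1⟩))) =
          χ.char g * ψ (d4Momentum g (fermiPolar μ (Complex.arg ⟨k 0, k 1⟩))) := fun g => by
      rw [if_neg (d4Momentum_ne_zero g hk), fermiPolar_arg_d4Momentum hμ₁ hμ₂ g hk]
    rw [Finset.sum_congr rfl fun g _ => hsum g]
    have hψ := congrFun h (fermiPolar μ (Complex.arg ⟨k 0, k 1⟩))
    rw [d4Project] at hψ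
    exact hψ

end Radial

end Literature.MathematicalPhysics.QuantumLattice

end
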